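import Literature.Probability.LatticeModels.PolymerGas

/-!
# Hard-core Ursell coefficients: Möbius inversion over set partitions, the rooted recursion, and the tree-sum bound

Topic `Literature/Probability/LatticeModels` (companion of `PolymerGas`; support for the
low-density expansion of the canonical hard-sphere gas behind
`Literature.MathematicalPhysics.KineticTheory.localGibbs_densityLLN`, `KineticTheory/HardSphereEulerProofs`).

The combinatorial core of every Mayer/cluster expansion with a **hard-core** (repulsive
`{0, -1}`-valued) interaction, in the set-up of Friedli–Velenik, Ch. 5: for a finite vertex set
`V` and a symmetric adjacency `H` ("overlap"), the Boltzmann factor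
`∏_{u ≠ w} (1 + f_{uw})`, `f = -𝟙_H`, is the indicator that `V` spans no edge, and the
"`+1 - 1` trick" writes it as a sum over graphs, i.e. — grouping a graph by its connected
components — as a sum over **set partitions** of `V` of products of **Ursell coefficients** of
the blocks (Friedli–Velenik §5.3, (5.5) and the proof of Prop. 5.3). Everything below is derived
from this single identity, with no graphs:

* `setPartitions V` (finset of set partitions of a finset, as families of blocks; these are
  exactly the `parts` of Mathlib's `Finpartition V`, `mem_setPartitions_iff_exists_finpartition`,
  `isSetPartition_parts`, `IsSetPartition.toFinpartition`) with the block decomposition at a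
  vertex (`sum_setPartitions_eq_sum_block`), the marked decomposition
  (`sum_block_setPartitions_setPartitions`) and transport along embeddings
  (`setPartitions_map`).
* `hcUrsell H V : ℤ`, **defined by Möbius inversion** so that the Mayer identity
  `∑_{π ∈ setPartitions V} ∏_{P ∈ π} hcUrsell H P = 𝟙[V edge-free]` holds
  (`sum_setPartitions_prod_hcUrsell`); for the overlap graph of a configuration this *is* the
  Ursell function `∑_{G ⊆ H[V] connected, spanning} (-1)^{#E(G)}` of (5.5) (both are determined
  by the identity, by induction on `#V`).
* **The rooted recursion** (`hcUrsell_eq_hcRootedUrsell`, Friedli–Velenik (5.13)–(5.14) for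
  `ζ ∈ {0,-1}`): for every `v ∈ V`,
  `hcUrsell H V = ∑_{ρ ∈ setPartitions (V \ v)} (-1)^{#ρ} ∏_{Q ∈ ρ} 𝟙[Q ∼ v] · hcUrsell H Q`
  (delete `v`: the components of the rest are each attached to `v`, and the alternating sum
  over the nonempty sets of edges to `v` is `∏ (1 + ζ) - 1 = -𝟙[Q ∼ v]`). Proved from the
  defining identity alone: both sides satisfy the same block decomposition.
* Consequences: relabelling invariance (`hcUrsell_map`, `hcUrsell_congr`), **locality**
  (`hcUrsell_ne_zero_le`: `hcUrsell H V ≠ 0` forces `H`-diameter `≤ #V - 1`, i.e. connectedness),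
  `hcUrsell_singleton`, `hcUrsell_pair`.
* **Tree numbers** `treeNumber` (`1, 1, 3, 16, 125, …`, Cayley's `k^{k-2}`, *defined* by the
  vertex-deletion recursion `t(k+1) = ∑_{ρ ∈ setPartitions [k]} ∏_Q #Q · t(#Q)`; size
  invariance `sum_setPartitions_prod_card_mul_treeNumber`) — the majorant produced by the rooted
  recursion (`|𝟙[Q ∼ v]| ≤ #{u ∈ Q : u ∼ v}`) once integrated, see `HardCoreCanonical`.
* **The tree-sum bound** (`treeSum_le_exp_one`; the induction (5.12) of Friedli–Velenik
  Thm. 5.4 in its simplest instance): if `e · x · #W ≤ 1` then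
  `∑_{V ⊆ W} t(#V + 1) x^{#V} ≤ e`; in binomial and exponential-generating form
  (`sum_choose_mul_treeNumber_mul_pow_le`, `sum_range_treeNumber_mul_pow_div_factorial_le`:
  `∑_k t(k+1) yᵏ/k! ≤ e` for `e y ≤ 1`, i.e. `R(1/e) ≤ 1` for the rooted-tree series).

## Design

No `SimpleGraph`, no connectivity, no spanning trees: the Ursell coefficient is *defined* by the
inversion formula (well-founded recursion on `#V`), and the two structural facts one needs
downstream — the rooted recursion and locality — are theorems. This keeps the probabilistic
layer (expectations factorise over the blocks of a set partition) free of graph enumeration.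
Edge-freeness is `IsCompatible H V` of `PolymerGas` (Mathlib's `Set.Pairwise` of `¬ H`), which
only looks at distinct pairs, so reflexivity of `H` is irrelevant; symmetry is assumed where
needed as an explicit hypothesis (as in `PolymerGas`). Set partitions are kept as plain finsets of
finsets (`setPartitions V`, bridged both ways to Mathlib's `Finpartition V`) rather than as
`Finpartition`s because the recursions need the vertex-block decomposition, unions/markings of
partitions of different ground sets and transport along embeddings as sums over finsets, an API
`Finpartition` does not offer; the librarian can merge through the bridge.

## References

* S. Friedli, Y. Velenik, *Statistical Mechanics of Lattice Systems*, CUP 2017, §5.3 (the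
  `+1-1` trick, (5.4)–(5.5), Ursell functions, Prop. 5.3 and its proof: factorisation over
  connected components), §5.4 (Thm. 5.4, (5.10)–(5.12); proof, (5.13)–(5.14): deletion of the
  root vertex). [FriedliVelenik2017]
* E. Pulvirenti, D. Tsagkarogiannis, *Cluster expansion in the canonical ensemble*, Comm. Math.
  Phys. 316 (2012) 289–306, §3 (the canonical partition function as a polymer model on vertex
  sets `V ⊆ {1,…,N}` with activities `ζ_Λ(V) = ∑_{g ∈ 𝒞_V} ∫ ∏ f_{ij}`), §4 (tree-graph bound
  on `ζ_Λ(V)`). [PulvirentiTsagkarogiannis2012]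
* D. Ruelle, *Statistical Mechanics: Rigorous Results*, Benjamin 1969, §4.4 (Ursell functions,
  algebraic method). [Ruelle1969]
-/

open Finset

namespace Literature.Probability.LatticeModels

variable {α : Type*} [DecidableEq α]

/-! ## Set partitions of a finset -/

/-- `π` is a **set partition** of the finset `V`: a finite family of nonempty subsets of `V`
(the blocks) such that every element of `V` lies in exactly one block. [folklore] -/
def IsSetPartition (V : Finset α) (π : Finset (Finset α)) : Prop :=
  (∀ P ∈ π, P ⊆ V) ∧ ∅ ∉ π ∧ (∀ v ∈ V, ∃ P ∈ π, v ∈ P) ∧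
    ∀ P ∈ π, ∀ Q ∈ π, ∀ v ∈ P, v ∈ Q → P = Q

/-- Being a set partition is decidable. [folklore] -/
instance (V : Finset α) (π : Finset (Finset α)) : Decidable (IsSetPartition V π) := by
  unfold IsSetPartition; infer_instance

/-- The finset of **set partitions** of `V`. [folklore] -/
def setPartitions (V : Finset α) : Finset (Finset (Finset α)) :=
  V.powerset.powerset.filter (IsSetPartition V)

omit [DecidableEq α] in
/-- Blocks are subsets. [folklore] -/
theorem IsSetPartition.subset {V : Finset α} {π : Finset (Finset α)} (h : IsSetPartition V π)
    {P : Finset α} (hP : P ∈ π) : P ⊆ V := h.1 P hP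

omit [DecidableEq α] in
/-- Blocks are nonempty. [folklore] -/
theorem IsSetPartition.nonempty_of_mem {V : Finset α} {π : Finset (Finset α)}
    (h : IsSetPartition V π) {P : Finset α} (hP : P ∈ π) : P.Nonempty := by
  rw [nonempty_iff_ne_empty]
  rintro rfl
  exact h.2.1 hP

omit [DecidableEq α] in
/-- Every element lies in some block. [folklore] -/
theorem IsSetPartition.exists_mem {V : Finset α} {π : Finset (Finset α)} (h : IsSetPartition V π)
    {v : α} (hv : v ∈ V) : ∃ P ∈ π, v ∈ P := h.2.2.1 v hv

omit [DecidableEq α] in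
/-- Blocks sharing an element are equal. [folklore] -/
theorem IsSetPartition.eq_of_mem {V : Finset α} {π : Finset (Finset α)} (h : IsSetPartition V π)
    {P Q : Finset α} (hP : P ∈ π) (hQ : Q ∈ π) {v : α} (hvP : v ∈ P) (hvQ : v ∈ Q) : P = Q :=
  h.2.2.2 P hP Q hQ v hvP hvQ

omit [DecidableEq α] in
/-- Distinct blocks are disjoint. [folklore] -/
theorem IsSetPartition.disjoint {V : Finset α} {π : Finset (Finset α)} (h : IsSetPartition V π)
    {P Q : Finset α} (hP : P ∈ π) (hQ : Q ∈ π) (hne : P ≠ Q) : Disjoint P Q :=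
  disjoint_left.2 fun _ hvP hvQ => hne (h.eq_of_mem hP hQ hvP hvQ)

omit [DecidableEq α] in
/-- The blocks form a pairwise disjoint family. [folklore] -/
theorem IsSetPartition.pairwiseDisjoint {V : Finset α} {π : Finset (Finset α)}
    (h : IsSetPartition V π) : (π : Set (Finset α)).PairwiseDisjoint id :=
  fun _ hP _ hQ hne => h.disjoint (mem_coe.1 hP) (mem_coe.1 hQ) hne

/-- Membership in `setPartitions`. [folklore] -/
theorem mem_setPartitions {V : Finset α} {π : Finset (Finset α)} :
    π ∈ setPartitions V ↔ IsSetPartition V π := by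
  simp only [setPartitions, mem_filter, mem_powerset, and_iff_right_iff_imp]
  intro h P hP
  exact mem_powerset.2 (h.subset hP)

/-- The union of the blocks is `V`. [folklore] -/
theorem IsSetPartition.biUnion_id {V : Finset α} {π : Finset (Finset α)} (h : IsSetPartition V π) :
    π.biUnion id = V := by
  ext v
  simp only [mem_biUnion, id]
  exact ⟨fun ⟨P, hP, hv⟩ => h.subset hP hv, fun hv => h.exists_mem hv⟩

/-- The block sizes add up to `#V`. [folklore] -/
theorem IsSetPartition.sum_card {V : Finset α} {π : Finset (Finset α)} (h : IsSetPartition V π) :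
    ∑ P ∈ π, P.card = V.card := by
  rw [← h.biUnion_id, card_biUnion h.pairwiseDisjoint]
  rfl

omit [DecidableEq α] in
/-- The only set partition of `∅` is the empty family. [folklore] -/
theorem isSetPartition_empty_iff {π : Finset (Finset α)} : IsSetPartition ∅ π ↔ π = ∅ := by
  constructor
  · intro h
    rw [eq_empty_iff_forall_notMem]
    intro P hP
    have hP' : P = ∅ := subset_empty.1 (h.subset hP)
    exact h.2.1 (hP' ▸ hP)
  · rintro rfl
    simp [IsSetPartition]

/-- `setPartitions ∅ = {∅}`. [folklore] -/
theorem setPartitions_empty : setPartitions (∅ : Finset α) = {∅} := by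
  ext π
  rw [mem_setPartitions, isSetPartition_empty_iff, mem_singleton]

omit [DecidableEq α] in
/-- The one-block partition. [folklore] -/
theorem isSetPartition_singleton {V : Finset α} (hV : V.Nonempty) : IsSetPartition V {V} := by
  refine ⟨fun P hP => by rw [mem_singleton.1 hP], fun h => ?_,
    fun v hv => ⟨V, mem_singleton_self V, hv⟩,
    fun P hP Q hQ _ _ _ => by rw [mem_singleton.1 hP, mem_singleton.1 hQ]⟩
  exact hV.ne_empty (mem_singleton.1 h).symm

omit [DecidableEq α] in
/-- A partition containing the block `V` is the one-block partition. [folklore] -/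
theorem IsSetPartition.eq_singleton_of_mem {V : Finset α} {π : Finset (Finset α)}
    (h : IsSetPartition V π) (hV : V ∈ π) : π = {V} := by
  ext Q
  simp only [mem_singleton]
  refine ⟨fun hQ => ?_, fun hQ => hQ ▸ hV⟩
  obtain ⟨v, hv⟩ := h.nonempty_of_mem hQ
  exact h.eq_of_mem hQ hV hv (h.subset hQ hv)

omit [DecidableEq α] in
/-- Blocks of a partition other than the one-block partition are proper subsets. [folklore] -/
theorem IsSetPartition.ssubset_of_ne_singleton {V : Finset α} {π : Finset (Finset α)}
    (h : IsSetPartition V π) (hπ : π ≠ {V}) {P : Finset α} (hP : P ∈ π) : P ⊂ V := by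
  refine lt_of_le_of_ne (h.subset hP) fun hPV => hπ ?_
  subst hPV
  exact h.eq_singleton_of_mem hP

omit [DecidableEq α] in
/-- Blocks of a partition of `V` have cardinality at most `#V`. [folklore] -/
theorem IsSetPartition.card_le {V : Finset α} {π : Finset (Finset α)} (h : IsSetPartition V π)
    {P : Finset α} (hP : P ∈ π) : P.card ≤ V.card :=
  card_le_card (h.subset hP)

/-! ### Bridge to Mathlib's `Finpartition` -/

omit [DecidableEq α] in
/-- The parts of a Mathlib `Finpartition` of `V` form a set partition in the present sense.
[folklore] -/
theorem isSetPartition_parts [DecidableEq α] {V : Finset α} (P : Finpartition V) :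
    IsSetPartition V P.parts :=
  ⟨fun _ hb => P.le hb, P.bot_notMem, fun _ hv => P.exists_mem hv,
    fun _ hB _ hQ _ hvB hvQ => (P.existsUnique_mem (P.le hB hvB)).unique ⟨hB, hvB⟩ ⟨hQ, hvQ⟩⟩

/-- Conversely a set partition is the family of parts of a `Finpartition`
(`Finpartition.ofExistsUnique`). [folklore] -/
def IsSetPartition.toFinpartition {V : Finset α} {π : Finset (Finset α)}
    (h : IsSetPartition V π) : Finpartition V :=
  Finpartition.ofExistsUnique π (fun P hP => h.subset hP)
    (fun v hv => by
      obtain ⟨P, hP, hvP⟩ := h.exists_mem hv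
      exact ⟨P, ⟨hP, hvP⟩, fun Q ⟨hQ, hvQ⟩ => h.eq_of_mem hQ hP hvQ hvP⟩)
    h.2.1

/-- The parts of `h.toFinpartition` are `π`. [folklore] -/
@[simp] theorem IsSetPartition.toFinpartition_parts {V : Finset α}
    {π : Finset (Finset α)} (h : IsSetPartition V π) : h.toFinpartition.parts = π := rfl

/-- **The bridge both ways**: `setPartitions V` is exactly the set of `parts` of the
`Finpartition`s of `V` (so it is in bijection with Mathlib's `Fintype (Finpartition V)`).
[folklore] -/
theorem mem_setPartitions_iff_exists_finpartition {V : Finset α} {π : Finset (Finset α)} :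
    π ∈ setPartitions V ↔ ∃ P : Finpartition V, P.parts = π := by
  rw [mem_setPartitions]
  exact ⟨fun h => ⟨h.toFinpartition, rfl⟩, fun ⟨P, hP⟩ => hP ▸ isSetPartition_parts P⟩

/-! ### The block of an element -/

/-- The block of `π` containing `v` (the union of the blocks containing `v`; junk `∅` if there is
none). [folklore] -/
def blockOf (π : Finset (Finset α)) (v : α) : Finset α :=
  (π.filter fun P => v ∈ P).biUnion id

/-- In a set partition, the blocks containing `v ∈ V` are exactly `blockOf π v`. [folklore] -/
theorem IsSetPartition.filter_mem_eq {V : Finset α} {π : Finset (Finset α)} (h : IsSetPartition V π)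
    {P : Finset α} (hP : P ∈ π) {v : α} (hvP : v ∈ P) : (π.filter fun Q => v ∈ Q) = {P} := by
  ext Q
  simp only [mem_filter, mem_singleton]
  exact ⟨fun ⟨hQ, hvQ⟩ => h.eq_of_mem hQ hP hvQ hvP, fun hQ => hQ ▸ ⟨hP, hvP⟩⟩

/-- A block containing `v` is `blockOf π v`. [folklore] -/
theorem IsSetPartition.eq_blockOf {V : Finset α} {π : Finset (Finset α)} (h : IsSetPartition V π)
    {P : Finset α} (hP : P ∈ π) {v : α} (hvP : v ∈ P) : blockOf π v = P := by
  rw [blockOf, h.filter_mem_eq hP hvP, singleton_biUnion, id]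

/-- `blockOf π v` is a block, for `v ∈ V`. [folklore] -/
theorem IsSetPartition.blockOf_mem {V : Finset α} {π : Finset (Finset α)} (h : IsSetPartition V π)
    {v : α} (hv : v ∈ V) : blockOf π v ∈ π := by
  obtain ⟨P, hP, hvP⟩ := h.exists_mem hv
  rwa [h.eq_blockOf hP hvP]

/-- `v ∈ blockOf π v`, for `v ∈ V`. [folklore] -/
theorem IsSetPartition.mem_blockOf {V : Finset α} {π : Finset (Finset α)} (h : IsSetPartition V π)
    {v : α} (hv : v ∈ V) : v ∈ blockOf π v := by
  obtain ⟨P, hP, hvP⟩ := h.exists_mem hv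
  rwa [h.eq_blockOf hP hvP]

/-! ### Removing and adding a block -/

/-- Removing a block leaves a partition of the complement. [folklore] -/
theorem IsSetPartition.erase {V : Finset α} {π : Finset (Finset α)} (h : IsSetPartition V π)
    {P₀ : Finset α} (hP₀ : P₀ ∈ π) : IsSetPartition (V \ P₀) (π.erase P₀) := by
  refine ⟨fun P hP => ?_, fun he => h.2.1 (mem_of_mem_erase he), fun v hv => ?_,
    fun P hP Q hQ v hvP hvQ => h.eq_of_mem (mem_of_mem_erase hP) (mem_of_mem_erase hQ) hvP hvQ⟩
  · obtain ⟨hne, hP⟩ := mem_erase.1 hP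
    exact subset_sdiff.2 ⟨h.subset hP, h.disjoint hP hP₀ hne⟩
  · obtain ⟨hvV, hvP₀⟩ := mem_sdiff.1 hv
    obtain ⟨P, hP, hvP⟩ := h.exists_mem hvV
    exact ⟨P, mem_erase.2 ⟨fun hPP₀ => hvP₀ (hPP₀ ▸ hvP), hP⟩, hvP⟩

/-- If `κ` partitions `V \ P₀` and `P₀` is nonempty then `P₀` is not a block of `κ`. [folklore] -/
theorem IsSetPartition.notMem_of_sdiff {V P₀ : Finset α} {κ : Finset (Finset α)}
    (hκ : IsSetPartition (V \ P₀) κ) (hP₀ : P₀.Nonempty) : P₀ ∉ κ := by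
  intro hmem
  obtain ⟨v, hv⟩ := hP₀
  exact (mem_sdiff.1 (hκ.subset hmem hv)).2 hv

/-- Adding a nonempty block to a partition of its complement gives a partition. [folklore] -/
theorem IsSetPartition.insert {V P₀ : Finset α} {κ : Finset (Finset α)}
    (hκ : IsSetPartition (V \ P₀) κ) (hP₀V : P₀ ⊆ V) (hP₀ : P₀.Nonempty) :
    IsSetPartition V (insert P₀ κ) := by
  refine ⟨fun P hP => ?_, fun he => ?_, fun v hv => ?_, fun P hP Q hQ v hvP hvQ => ?_⟩
  · rcases mem_insert.1 hP with rfl | hP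
    · exact hP₀V
    · exact (hκ.subset hP).trans sdiff_subset
  · rcases mem_insert.1 he with he | he
    · exact hP₀.ne_empty he.symm
    · exact hκ.2.1 he
  · by_cases hvP₀ : v ∈ P₀
    · exact ⟨P₀, mem_insert_self _ _, hvP₀⟩
    · obtain ⟨P, hP, hvP⟩ := hκ.exists_mem (mem_sdiff.2 ⟨hv, hvP₀⟩)
      exact ⟨P, mem_insert_of_mem hP, hvP⟩
  · rcases mem_insert.1 hP with hP | hP
    · rcases mem_insert.1 hQ with hQ | hQ
      · rw [hP, hQ]
      · exact absurd (hP ▸ hvP) (mem_sdiff.1 (hκ.subset hQ hvQ)).2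
    · rcases mem_insert.1 hQ with hQ | hQ
      · exact absurd (hQ ▸ hvQ) (mem_sdiff.1 (hκ.subset hP hvP)).2
      · exact hκ.eq_of_mem hP hQ hvP hvQ

/-- **Block decomposition.** Summing over the set partitions of `V` is summing over the block
`P₀ ∋ v` of a fixed element `v ∈ V` and over the set partitions of `V \ P₀`. [folklore] -/
theorem sum_setPartitions_eq_sum_block {M : Type*} [AddCommMonoid M] {V : Finset α} {v : α}
    (hv : v ∈ V) (f : Finset (Finset α) → M) :
    ∑ π ∈ setPartitions V, f π =
      ∑ P₀ ∈ V.powerset.filter (fun P => v ∈ P), ∑ κ ∈ setPartitions (V \ P₀),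
        f (insert P₀ κ) := by
  rw [sum_sigma']
  refine sum_nbij'
    (fun π => (⟨blockOf π v, π.erase (blockOf π v)⟩ : Σ _ : Finset α, Finset (Finset α)))
    (fun x => insert x.1 x.2) ?_ ?_ ?_ ?_ ?_
  · intro π hπ
    have h := mem_setPartitions.1 hπ
    simp only [mem_sigma, mem_filter, mem_powerset, mem_setPartitions]
    exact ⟨⟨h.subset (h.blockOf_mem hv), h.mem_blockOf hv⟩, h.erase (h.blockOf_mem hv)⟩
  · rintro ⟨P₀, κ⟩ hx
    simp only [mem_sigma, mem_filter, mem_powerset, mem_setPartitions] at hx ⊢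
    exact hx.2.insert hx.1.1 ⟨v, hx.1.2⟩
  · intro π hπ
    have h := mem_setPartitions.1 hπ
    exact insert_erase (h.blockOf_mem hv)
  · rintro ⟨P₀, κ⟩ hx
    simp only [mem_sigma, mem_filter, mem_powerset, mem_setPartitions] at hx
    have hins : IsSetPartition V (insert P₀ κ) := hx.2.insert hx.1.1 ⟨v, hx.1.2⟩
    have hb : blockOf (insert P₀ κ) v = P₀ := hins.eq_blockOf (mem_insert_self _ _) hx.1.2
    have hnot : P₀ ∉ κ := hx.2.notMem_of_sdiff ⟨v, hx.1.2⟩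
    simp only [hb, erase_insert hnot]
  · intro π hπ
    have h := mem_setPartitions.1 hπ
    simp only [insert_erase (h.blockOf_mem hv)]

/-! ### Sub-families, unions, and the marked decomposition -/

/-- A sub-family of a set partition is a set partition of its union. [folklore] -/
theorem IsSetPartition.of_subset {V : Finset α} {π ρ : Finset (Finset α)} (h : IsSetPartition V π)
    (hρ : ρ ⊆ π) : IsSetPartition (ρ.biUnion id) ρ := by
  refine ⟨fun P hP => subset_biUnion_of_mem id hP, fun he => h.2.1 (hρ he), fun v hv => ?_,
    fun P hP Q hQ v hvP hvQ => h.eq_of_mem (hρ hP) (hρ hQ) hvP hvQ⟩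
  simpa only [mem_biUnion, id] using hv

/-- The complement of a sub-family is a set partition of the complement of its union. [folklore] -/
theorem IsSetPartition.sdiff {V : Finset α} {π ρ : Finset (Finset α)} (h : IsSetPartition V π)
    (hρ : ρ ⊆ π) : IsSetPartition (V \ ρ.biUnion id) (π \ ρ) := by
  refine ⟨fun P hP => ?_, fun he => h.2.1 (mem_sdiff.1 he).1, fun v hv => ?_,
    fun P hP Q hQ v hvP hvQ => h.eq_of_mem (mem_sdiff.1 hP).1 (mem_sdiff.1 hQ).1 hvP hvQ⟩
  · obtain ⟨hPπ, hPρ⟩ := mem_sdiff.1 hP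
    refine subset_sdiff.2 ⟨h.subset hPπ, disjoint_left.2 fun u huP hu => ?_⟩
    obtain ⟨Q, hQ, huQ⟩ := mem_biUnion.1 hu
    exact hPρ ((h.eq_of_mem hPπ (hρ hQ) huP huQ) ▸ hQ)
  · obtain ⟨hvV, hvρ⟩ := mem_sdiff.1 hv
    obtain ⟨P, hP, hvP⟩ := h.exists_mem hvV
    refine ⟨P, mem_sdiff.2 ⟨hP, fun hPρ => hvρ ?_⟩, hvP⟩
    exact mem_biUnion.2 ⟨P, hPρ, hvP⟩

omit [DecidableEq α] in
/-- The union of set partitions of disjoint sets is a set partition of the union. [folklore] -/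
theorem IsSetPartition.union [DecidableEq α] {A B : Finset α} {ρ κ : Finset (Finset α)}
    (hρ : IsSetPartition A ρ) (hκ : IsSetPartition B κ) (hAB : Disjoint A B) :
    IsSetPartition (A ∪ B) (ρ ∪ κ) := by
  refine ⟨fun P hP => ?_, fun he => ?_, fun v hv => ?_, fun P hP Q hQ v hvP hvQ => ?_⟩
  · rcases mem_union.1 hP with hP | hP
    · exact (hρ.subset hP).trans subset_union_left
    · exact (hκ.subset hP).trans subset_union_right
  · rcases mem_union.1 he with he | he
    · exact hρ.2.1 he
    · exact hκ.2.1 he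
  · rcases mem_union.1 hv with hv | hv
    · obtain ⟨P, hP, hvP⟩ := hρ.exists_mem hv
      exact ⟨P, mem_union_left _ hP, hvP⟩
    · obtain ⟨P, hP, hvP⟩ := hκ.exists_mem hv
      exact ⟨P, mem_union_right _ hP, hvP⟩
  · rcases mem_union.1 hP with hP | hP <;> rcases mem_union.1 hQ with hQ | hQ
    · exact hρ.eq_of_mem hP hQ hvP hvQ
    · exact absurd (hκ.subset hQ hvQ) (disjoint_left.1 hAB (hρ.subset hP hvP))
    · exact absurd (hκ.subset hP hvP) (disjoint_left.1 hAB (hρ.subset hQ hvQ))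
    · exact hκ.eq_of_mem hP hQ hvP hvQ

omit [DecidableEq α] in
/-- Set partitions of disjoint sets are disjoint families. [folklore] -/
theorem IsSetPartition.disjoint_family [DecidableEq α] {A B : Finset α} {ρ κ : Finset (Finset α)}
    (hρ : IsSetPartition A ρ) (hκ : IsSetPartition B κ) (hAB : Disjoint A B) : Disjoint ρ κ := by
  refine disjoint_left.2 fun P hPρ hPκ => ?_
  obtain ⟨v, hv⟩ := hρ.nonempty_of_mem hPρ
  exact disjoint_left.1 hAB (hρ.subset hPρ hv) (hκ.subset hPκ hv)

/-- **Marked decomposition.** For `v ∈ V`: choosing a set `P₀ ∋ v`, a set partition `ρ` of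
`P₀ \ {v}` and a set partition `κ` of `V \ P₀` is the same as choosing a set partition
`π = ρ ∪ κ` of `V \ {v}` together with the marked sub-family `ρ ⊆ π`. [folklore] -/
theorem sum_block_setPartitions_setPartitions {M : Type*} [AddCommMonoid M] {V : Finset α}
    {v : α} (hv : v ∈ V) (F : Finset (Finset α) → Finset (Finset α) → M) :
    ∑ P₀ ∈ V.powerset.filter (fun P => v ∈ P), ∑ ρ ∈ setPartitions (P₀.erase v),
        ∑ κ ∈ setPartitions (V \ P₀), F ρ κ =
      ∑ π ∈ setPartitions (V.erase v), ∑ ρ ∈ π.powerset, F ρ (π \ ρ) := by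
  simp_rw [← sum_product']
  rw [sum_sigma', sum_sigma']
  refine sum_nbij'
    (fun x => (⟨x.2.1 ∪ x.2.2, x.2.1⟩ : Σ _ : Finset (Finset α), Finset (Finset α)))
    (fun y => (⟨insert v (y.2.biUnion id), (y.2, y.1 \ y.2)⟩ :
      Σ _ : Finset α, Finset (Finset α) × Finset (Finset α))) ?_ ?_ ?_ ?_ ?_
  · -- into
    rintro ⟨P₀, ρ, κ⟩ hx
    simp only [mem_sigma, mem_filter, mem_powerset, mem_product, mem_setPartitions] at hx ⊢
    obtain ⟨⟨hP₀V, hvP₀⟩, hρ, hκ⟩ := hx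
    refine ⟨?_, subset_union_left⟩
    have hdisj : Disjoint (P₀.erase v) (V \ P₀) :=
      disjoint_left.2 fun u hu hu' => (mem_sdiff.1 hu').2 (mem_of_mem_erase hu)
    have hVv : P₀.erase v ∪ V \ P₀ = V.erase v := by
      ext u
      simp only [mem_union, mem_erase, mem_sdiff]
      constructor
      · rintro (⟨hne, hu⟩ | ⟨hu, hu'⟩)
        · exact ⟨hne, hP₀V hu⟩
        · exact ⟨fun h => hu' (h ▸ hvP₀), hu⟩
      · rintro ⟨hne, hu⟩
        by_cases h : u ∈ P₀
        · exact Or.inl ⟨hne, h⟩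
        · exact Or.inr ⟨hu, h⟩
    exact hVv ▸ hρ.union hκ hdisj
  · -- from
    rintro ⟨π, ρ⟩ hy
    simp only [mem_sigma, mem_filter, mem_powerset, mem_product, mem_setPartitions] at hy ⊢
    obtain ⟨hπ, hρπ⟩ := hy
    have hUsub : ρ.biUnion id ⊆ V.erase v := by
      intro u hu
      obtain ⟨Q, hQ, huQ⟩ := mem_biUnion.1 hu
      exact hπ.subset (hρπ hQ) huQ
    have hvU : v ∉ ρ.biUnion id := fun h => (mem_erase.1 (hUsub h)).1 rfl
    refine ⟨⟨?_, mem_insert_self _ _⟩, ?_, ?_⟩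
    · exact insert_subset hv (hUsub.trans (erase_subset _ _))
    · rw [erase_insert hvU]
      exact hπ.of_subset hρπ
    · have hset : V \ insert v (ρ.biUnion id) = V.erase v \ ρ.biUnion id := by
        ext u
        simp only [mem_sdiff, mem_insert, mem_erase, not_or]
        tauto
      rw [hset]
      exact hπ.sdiff hρπ
  · -- left inverse
    rintro ⟨P₀, ρ, κ⟩ hx
    simp only [mem_sigma, mem_filter, mem_powerset, mem_product, mem_setPartitions] at hx
    obtain ⟨⟨hP₀V, hvP₀⟩, hρ, hκ⟩ := hx
    have hdisj : Disjoint (P₀.erase v) (V \ P₀) :=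
      disjoint_left.2 fun u hu hu' => (mem_sdiff.1 hu').2 (mem_of_mem_erase hu)
    have hρκ : Disjoint ρ κ := hρ.disjoint_family hκ hdisj
    have h1 : insert v (ρ.biUnion id) = P₀ := by rw [hρ.biUnion_id, insert_erase hvP₀]
    have h2 : (ρ ∪ κ) \ ρ = κ := union_sdiff_cancel_left hρκ
    simp only [h1, h2]
  · -- right inverse
    rintro ⟨π, ρ⟩ hy
    simp only [mem_sigma, mem_powerset, mem_setPartitions] at hy
    simp only [union_sdiff_of_subset hy.2]
  · -- weights
    rintro ⟨P₀, ρ, κ⟩ hx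
    simp only [mem_sigma, mem_filter, mem_powerset, mem_product, mem_setPartitions] at hx
    obtain ⟨⟨hP₀V, hvP₀⟩, hρ, hκ⟩ := hx
    have hdisj : Disjoint (P₀.erase v) (V \ P₀) :=
      disjoint_left.2 fun u hu hu' => (mem_sdiff.1 hu').2 (mem_of_mem_erase hu)
    have hρκ : Disjoint ρ κ := hρ.disjoint_family hκ hdisj
    simp only [union_sdiff_cancel_left hρκ]

/-! ## Hard-core Ursell coefficients -/

section Ursell

variable (H : α → α → Prop)

omit [DecidableEq α] in
/-- `V` spans no `H`-edge (`IsCompatible H V` of `PolymerGas`: no two distinct elements of `V` are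
`H`-related; for the overlap graph of a hard-sphere configuration: the spheres labelled by `V` do
not overlap), in bounded-quantifier form. [folklore] -/
theorem isCompatible_iff' (V : Finset α) :
    IsCompatible H V ↔ ∀ u ∈ V, ∀ w ∈ V, u ≠ w → ¬ H u w := by
  simp only [IsCompatible, Set.Pairwise, mem_coe]

variable [DecidableRel H]

/-- The indicator `𝟙[V is edge-free] ∈ ℤ` (edge-free = `IsCompatible H V` of `PolymerGas`) — the
hard-core Boltzmann factor `∏_{u ≠ w ∈ V} (1 + f_{uw})`, `f = -𝟙_H`. [folklore] -/
def edgeFreeInd (V : Finset α) : ℤ := if IsCompatible H V then 1 else 0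

/-- `edgeFreeInd` only depends on the truth value of edge-freeness. [folklore] -/
theorem edgeFreeInd_congr_of_iff {H' : α → α → Prop} [DecidableRel H'] {V V' : Finset α}
    (h : IsCompatible H V ↔ IsCompatible H' V') : edgeFreeInd H V = edgeFreeInd H' V' := by
  unfold edgeFreeInd
  exact if_congr h rfl rfl

variable {H} in
/-- Blocks of a set partition of `V` other than `{V}` have smaller cardinality (termination of the
Möbius recursion). [folklore] -/
theorem card_lt_of_mem_erase_setPartitions {V : Finset α} {π : Finset (Finset α)}
    (hπ : π ∈ (setPartitions V).erase {V}) {P : Finset α} (hP : P ∈ π) : P.card < V.card := by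
  obtain ⟨hne, hπ⟩ := mem_erase.1 hπ
  exact card_lt_card ((mem_setPartitions.1 hπ).ssubset_of_ne_singleton hne hP)

/-- **The hard-core Ursell coefficient** `c_H(V)` of a finite vertex set `V` for the adjacency
`H`, defined by Möbius inversion over set partitions so that
`∑_{π ∈ setPartitions V} ∏_{P ∈ π} c_H(P) = 𝟙[V edge-free]` (`sum_setPartitions_prod_hcUrsell`):
`c_H(V) = 𝟙[V edge-free] - ∑_{π ≠ {V}} ∏_{P ∈ π} c_H(P)`. For the overlap graph of a point
configuration this is the Ursell (connected Mayer) function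
`∑_{G connected on V} ∏_{uw ∈ G} f_{uw}` of the hard-core gas, `f = -𝟙_{overlap}`
(Friedli–Velenik (5.5), up to the factor `1/m!` of their ordered families; Ruelle 1969, §4.4),
but no graphs are used here: all properties are derived from the defining identity. Junk value
on `∅` (never a block). [cite: FriedliVelenik2017, §5.3 (5.5)] -/
def hcUrsell (V : Finset α) : ℤ :=
  edgeFreeInd H V -
    ∑ π ∈ ((setPartitions V).erase {V}).attach, ∏ P ∈ π.1.attach, hcUrsell P.1
termination_by V.card
decreasing_by exact card_lt_of_mem_erase_setPartitions π.2 P.2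

/-- Unfolding the Möbius recursion. [folklore] -/
theorem hcUrsell_eq (V : Finset α) :
    hcUrsell H V = edgeFreeInd H V - ∑ π ∈ (setPartitions V).erase {V}, ∏ P ∈ π, hcUrsell H P := by
  rw [hcUrsell]
  congr 1
  rw [sum_attach ((setPartitions V).erase {V}) (fun π => ∏ P ∈ π.attach, hcUrsell H P.1)]
  exact sum_congr rfl fun π _ => prod_attach π (hcUrsell H)

/-- **The defining identity (hard-core Mayer expansion).** For every finite `V`,
`∑_{π ∈ setPartitions V} ∏_{P ∈ π} c_H(P) = 𝟙[V is edge-free]`: the Boltzmann factor of a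
hard-core gas is the sum over set partitions of the product of the Ursell coefficients of the
blocks (the `+1-1` trick (5.4)–(5.5) grouped by connected components, proof of Prop. 5.3).
[cite: FriedliVelenik2017, §5.3, proof of Prop. 5.3] -/
theorem sum_setPartitions_prod_hcUrsell (V : Finset α) :
    ∑ π ∈ setPartitions V, ∏ P ∈ π, hcUrsell H P = edgeFreeInd H V := by
  rcases V.eq_empty_or_nonempty with rfl | hV
  · simp [setPartitions_empty, edgeFreeInd, IsCompatible]
  · have hmem : {V} ∈ setPartitions V := mem_setPartitions.2 (isSetPartition_singleton hV)
    rw [← add_sum_erase _ _ hmem, prod_singleton, hcUrsell_eq]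
    ring

/-- The indicator that the block `Q` is adjacent to the vertex `v`. [folklore] -/
def adjInd (v : α) (Q : Finset α) : ℤ := if ∃ u ∈ Q, H v u then 1 else 0

/-- The rooted expansion of the Ursell coefficient at `v`:
`d_v(P) = ∑_{ρ ∈ setPartitions (P \ {v})} (-1)^{#ρ} ∏_{Q ∈ ρ} 𝟙[Q ∼ v] c_H(Q)`. [folklore] -/
def hcRootedUrsell (v : α) (P : Finset α) : ℤ :=
  ∑ ρ ∈ setPartitions (P.erase v), (-1) ^ ρ.card * ∏ Q ∈ ρ, (adjInd H v Q * hcUrsell H Q)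

variable {H}

/-- Block decomposition of the defining identity at `v ∈ V`:
`∑_{P₀ ∋ v} c_H(P₀) 𝟙[V \ P₀ edge-free] = 𝟙[V edge-free]`. [folklore] -/
theorem sum_hcUrsell_mul_edgeFreeInd {V : Finset α} {v : α} (hv : v ∈ V) :
    ∑ P₀ ∈ V.powerset.filter (fun P => v ∈ P), hcUrsell H P₀ * edgeFreeInd H (V \ P₀) =
      edgeFreeInd H V := by
  rw [← sum_setPartitions_prod_hcUrsell, sum_setPartitions_eq_sum_block hv]
  refine sum_congr rfl fun P₀ hP₀ => ?_
  rw [← sum_setPartitions_prod_hcUrsell, mul_sum]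
  refine sum_congr rfl fun κ hκ => ?_
  have hvP₀ : v ∈ P₀ := (mem_filter.1 hP₀).2
  rw [prod_insert ((mem_setPartitions.1 hκ).notMem_of_sdiff ⟨v, hvP₀⟩)]

/-- If `v` has a neighbour `u ≠ v` in `V` then `V` is not edge-free. [folklore] -/
theorem edgeFreeInd_eq_zero_of_adj {V : Finset α} {v u : α} (hv : v ∈ V) (hu : u ∈ V) (hne : v ≠ u)
    (hH : H v u) : edgeFreeInd H V = 0 := by
  rw [edgeFreeInd, if_neg]
  exact fun h => (isCompatible_iff' H V).1 h v hv u hu hne hH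

/-- If `v` has no neighbour in `V \ {v}` (and `H` is symmetric) then `V` is edge-free iff `V \ {v}`
is. [folklore] -/
theorem edgeFreeInd_eq_erase (hsymm : ∀ a b, H a b → H b a) {V : Finset α} {v : α}
    (hno : ¬ ∃ u ∈ V.erase v, H v u) : edgeFreeInd H V = edgeFreeInd H (V.erase v) := by
  refine edgeFreeInd_congr_of_iff H ?_
  rw [isCompatible_iff', isCompatible_iff']
  push Not at hno
  refine ⟨fun h u hu w hw huw => h u (mem_of_mem_erase hu) w (mem_of_mem_erase hw) huw,
    fun h u hu w hw huw hH => ?_⟩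
  by_cases huv : u = v
  · subst huv
    exact hno w (mem_erase.2 ⟨Ne.symm huw, hw⟩) hH
  · by_cases hwv : w = v
    · subst hwv
      exact hno u (mem_erase.2 ⟨huv, hu⟩) (hsymm _ _ hH)
    · exact h u (mem_erase.2 ⟨huv, hu⟩) w (mem_erase.2 ⟨hwv, hw⟩) huw hH

/-- The marked computation: `∑_{P₀ ∋ v} d_v(P₀) 𝟙[V \ P₀ edge-free] = 𝟙[V edge-free]`
(marked decomposition, `∏ (1 - 𝟙[Q ∼ v]) c_H(Q)` by the binomial expansion over sub-families, and
the defining identity for `V \ {v}`). [folklore] -/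
theorem sum_hcRootedUrsell_mul_edgeFreeInd (hsymm : ∀ a b, H a b → H b a) {V : Finset α} {v : α}
    (hv : v ∈ V) :
    ∑ P₀ ∈ V.powerset.filter (fun P => v ∈ P), hcRootedUrsell H v P₀ * edgeFreeInd H (V \ P₀) =
      edgeFreeInd H V := by
  have step1 : ∀ P₀ ∈ V.powerset.filter (fun P => v ∈ P),
      hcRootedUrsell H v P₀ * edgeFreeInd H (V \ P₀) =
        ∑ ρ ∈ setPartitions (P₀.erase v), ∑ κ ∈ setPartitions (V \ P₀),
          ((-1) ^ ρ.card * ∏ Q ∈ ρ, (adjInd H v Q * hcUrsell H Q)) * ∏ Q ∈ κ, hcUrsell H Q := by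
    intro P₀ _
    rw [hcRootedUrsell, ← sum_setPartitions_prod_hcUrsell, sum_mul_sum]
  rw [sum_congr rfl step1, sum_block_setPartitions_setPartitions hv]
  -- binomial recombination
  have step2 : ∀ π ∈ setPartitions (V.erase v),
      ∑ ρ ∈ π.powerset, ((-1) ^ ρ.card * ∏ Q ∈ ρ, (adjInd H v Q * hcUrsell H Q)) *
          ∏ Q ∈ π \ ρ, hcUrsell H Q =
        ∏ Q ∈ π, (1 - adjInd H v Q) * hcUrsell H Q := by
    intro π _
    have : ∀ Q, (1 - adjInd H v Q) * hcUrsell H Q = -(adjInd H v Q * hcUrsell H Q) + hcUrsell H Q := by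
      intro Q; ring
    simp_rw [this, prod_add, prod_neg]
  rw [sum_congr rfl step2]
  by_cases hadj : ∃ u ∈ V.erase v, H v u
  · -- an edge at `v`: every partition has a block adjacent to `v`
    obtain ⟨u, hu, hH⟩ := hadj
    rw [edgeFreeInd_eq_zero_of_adj hv (mem_of_mem_erase hu) (mem_erase.1 hu).1.symm hH]
    refine sum_eq_zero fun π hπ => ?_
    have h := mem_setPartitions.1 hπ
    refine prod_eq_zero (h.blockOf_mem hu) ?_
    have : adjInd H v (blockOf π u) = 1 := if_pos ⟨u, h.mem_blockOf hu, hH⟩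
    rw [this, sub_self, zero_mul]
  · -- no edge at `v`
    rw [edgeFreeInd_eq_erase hsymm hadj, ← sum_setPartitions_prod_hcUrsell]
    refine sum_congr rfl fun π hπ => prod_congr rfl fun Q hQ => ?_
    have h := mem_setPartitions.1 hπ
    have : adjInd H v Q = 0 := by
      refine if_neg ?_
      rintro ⟨u, huQ, hH⟩
      exact hadj ⟨u, h.subset hQ huQ, hH⟩
    rw [this, sub_zero, one_mul]

/-- **Rooted recursion for the Ursell coefficient** (vertex-deletion recursion; the tree-graph
structure behind the tree-graph bounds of cluster expansions). For symmetric `H` and every `v ∈ V`,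
`c_H(V) = ∑_{ρ ∈ setPartitions (V \ {v})} (-1)^{#ρ} ∏_{Q ∈ ρ} 𝟙[Q ∼ v] c_H(Q)`:
deleting `v` from a connected graph leaves connected components, each joined to `v`, and the
alternating sum over the nonempty edge sets to `v` is `∏ (1 + ζ) - 1 = -1` per component
(Friedli–Velenik (5.13)–(5.14) with `ζ ∈ {0, -1}`). Proved from the defining identity alone
(both sides satisfy the same block decomposition, induction on `#V`).
[cite: FriedliVelenik2017, §5.4, proof of Thm. 5.4, (5.13)–(5.14)] -/
theorem hcUrsell_eq_hcRootedUrsell (hsymm : ∀ a b, H a b → H b a) {V : Finset α} {v : α} (hv : v ∈ V) :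
    hcUrsell H V = hcRootedUrsell H v V := by
  induction V using Finset.strongInduction with
  | H V ih =>
    have key := (sum_hcUrsell_mul_edgeFreeInd (H := H) hv).trans
      (sum_hcRootedUrsell_mul_edgeFreeInd hsymm hv).symm
    have hVmem : V ∈ V.powerset.filter (fun P => v ∈ P) :=
      mem_filter.2 ⟨mem_powerset.2 Subset.rfl, hv⟩
    rw [← add_sum_erase _ _ hVmem, ← add_sum_erase _ _ hVmem] at key
    have hrest : ∑ P₀ ∈ (V.powerset.filter (fun P => v ∈ P)).erase V,
        hcUrsell H P₀ * edgeFreeInd H (V \ P₀) =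
        ∑ P₀ ∈ (V.powerset.filter (fun P => v ∈ P)).erase V,
          hcRootedUrsell H v P₀ * edgeFreeInd H (V \ P₀) := by
      refine sum_congr rfl fun P₀ hP₀ => ?_
      obtain ⟨hne, hP₀⟩ := mem_erase.1 hP₀
      obtain ⟨hP₀V, hvP₀⟩ := mem_filter.1 hP₀
      rw [ih P₀ (lt_of_le_of_ne (mem_powerset.1 hP₀V) hne) hvP₀]
    have h1 : edgeFreeInd H (V \ V) = 1 := by simp [edgeFreeInd, IsCompatible]
    rw [hrest, h1, mul_one, mul_one] at key
    exact add_right_cancel key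

/-- The set partitions of a singleton. [folklore] -/
theorem setPartitions_singleton (v : α) : setPartitions ({v} : Finset α) = {{{v}}} := by
  ext π
  rw [mem_setPartitions, mem_singleton]
  constructor
  · intro h
    obtain ⟨P, hP, hvP⟩ := h.exists_mem (mem_singleton_self v)
    have hPv : P = {v} :=
      Subset.antisymm (h.subset hP) (singleton_subset_iff.2 hvP)
    subst hPv
    exact h.eq_singleton_of_mem hP
  · rintro rfl
    exact isSetPartition_singleton (singleton_nonempty v)

/-- A singleton is edge-free. [folklore] -/
@[simp] theorem edgeFreeInd_singleton (v : α) : edgeFreeInd H {v} = 1 := by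
  rw [edgeFreeInd, if_pos]
  rw [isCompatible_iff']
  intro u hu w hw huw
  exact (huw ((mem_singleton.1 hu).trans (mem_singleton.1 hw).symm)).elim

/-- The Ursell coefficient of a singleton is `1`. [folklore] -/
@[simp] theorem hcUrsell_singleton (v : α) : hcUrsell H {v} = 1 := by
  rw [hcUrsell_eq, setPartitions_singleton, erase_singleton, sum_empty, sub_zero,
    edgeFreeInd_singleton]

/-- The Ursell coefficient of a pair is `-𝟙[u ∼ w]` (the single Mayer bond `f_{uw}`).
[cite: FriedliVelenik2017, §5.3 (5.5)] -/
theorem hcUrsell_pair (hsymm : ∀ a b, H a b → H b a) {u w : α} (huw : u ≠ w) :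
    hcUrsell H {u, w} = -(if H u w then 1 else 0) := by
  rw [hcUrsell_eq_hcRootedUrsell hsymm (mem_insert_self u {w}), hcRootedUrsell,
    erase_insert (by simpa using huw), setPartitions_singleton, sum_singleton, card_singleton,
    prod_singleton, hcUrsell_singleton, mul_one, pow_one, adjInd]
  simp only [mem_singleton, exists_eq_left, neg_mul, one_mul]

/-! ### A uniform bound -/

/-- A bound on `|hcUrsell H V|` independent of `H`, by the same Möbius recursion with absolute
values: `U(V) = 1 + ∑_{π ≠ {V}} ∏_{P ∈ π} U(P)`. [folklore] -/
def hcUrsellBound (V : Finset α) : ℕ :=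
  1 + ∑ π ∈ ((setPartitions V).erase {V}).attach, ∏ P ∈ π.1.attach, hcUrsellBound P.1
termination_by V.card
decreasing_by exact card_lt_of_mem_erase_setPartitions π.2 P.2

/-- Unfolding `hcUrsellBound`. [folklore] -/
theorem hcUrsellBound_eq (V : Finset α) :
    hcUrsellBound V = 1 + ∑ π ∈ (setPartitions V).erase {V}, ∏ P ∈ π, hcUrsellBound P := by
  rw [hcUrsellBound]
  congr 1
  rw [sum_attach ((setPartitions V).erase {V}) (fun π => ∏ P ∈ π.attach, hcUrsellBound P.1)]
  exact sum_congr rfl fun π _ => prod_attach π hcUrsellBound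

/-- `|hcUrsell H V| ≤ hcUrsellBound V` for every adjacency `H`. [folklore] -/
theorem abs_hcUrsell_le_hcUrsellBound (V : Finset α) : |hcUrsell H V| ≤ hcUrsellBound V := by
  induction V using Finset.strongInduction with
  | H V ih =>
    rw [hcUrsell_eq, hcUrsellBound_eq, Nat.cast_add, Nat.cast_one, Nat.cast_sum]
    refine (abs_sub _ _).trans (add_le_add ?_ ((abs_sum_le_sum_abs _ _).trans (sum_le_sum ?_)))
    · unfold edgeFreeInd; split_ifs <;> simp
    · intro π hπ
      rw [abs_prod, Nat.cast_prod]
      obtain ⟨hne, hπ'⟩ := mem_erase.1 hπ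
      exact prod_le_prod (fun P _ => abs_nonneg _) fun P hP =>
        ih P ((mem_setPartitions.1 hπ').ssubset_of_ne_singleton hne hP)

/-! ### Congruence and transport -/

/-- The Ursell coefficient of `V` only depends on `H` restricted to `V`. [folklore] -/
theorem hcUrsell_congr {H' : α → α → Prop} [DecidableRel H'] {V : Finset α}
    (hHH' : ∀ u ∈ V, ∀ w ∈ V, (H u w ↔ H' u w)) : hcUrsell H V = hcUrsell H' V := by
  induction V using Finset.strongInduction with
  | H V ih =>
    rw [hcUrsell_eq, hcUrsell_eq]
    have hE : edgeFreeInd H V = edgeFreeInd H' V := by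
      refine edgeFreeInd_congr_of_iff H ?_
      rw [isCompatible_iff', isCompatible_iff']
      exact forall₂_congr fun u hu => forall₂_congr fun w hw =>
        imp_congr_right fun _ => not_congr (hHH' u hu w hw)
    rw [hE]
    congr 1
    refine sum_congr rfl fun π hπ => prod_congr rfl fun P hP => ?_
    obtain ⟨hne, hπ'⟩ := mem_erase.1 hπ
    have h := mem_setPartitions.1 hπ'
    exact ih P (h.ssubset_of_ne_singleton hne hP) fun u hu w hw =>
      hHH' u (h.subset hP hu) w (h.subset hP hw)

end Ursell

section Map

variable {β : Type*} [DecidableEq β] (e : α ↪ β)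

omit [DecidableEq α] [DecidableEq β] in
/-- The image of a set partition under an embedding is a set partition of the image. [folklore] -/
theorem IsSetPartition.map {V : Finset α} {π : Finset (Finset α)} (h : IsSetPartition V π) :
    IsSetPartition (V.map e) (π.map (mapEmbedding e).toEmbedding) := by
  refine ⟨fun P' hP' => ?_, fun he => ?_, fun b hb => ?_, fun P' hP' Q' hQ' b hbP hbQ => ?_⟩
  · obtain ⟨P, hP, rfl⟩ := mem_map.1 hP'
    exact map_subset_map.2 (h.subset hP)
  · obtain ⟨P, hP, hPe⟩ := mem_map.1 he
    have : P = ∅ := by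
      rw [RelEmbedding.coe_toEmbedding, mapEmbedding_apply, map_eq_empty] at hPe
      exact hPe
    exact h.2.1 (this ▸ hP)
  · obtain ⟨v, hv, rfl⟩ := mem_map.1 hb
    obtain ⟨P, hP, hvP⟩ := h.exists_mem hv
    exact ⟨P.map e, mem_map.2 ⟨P, hP, rfl⟩, mem_map_of_mem e hvP⟩
  · obtain ⟨P, hP, rfl⟩ := mem_map.1 hP'
    obtain ⟨Q, hQ, rfl⟩ := mem_map.1 hQ'
    simp only [RelEmbedding.coe_toEmbedding, mapEmbedding_apply] at hbP hbQ ⊢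
    obtain ⟨u, hu, rfl⟩ := mem_map.1 hbP
    obtain ⟨w, hw, huw⟩ := mem_map.1 hbQ
    rw [e.injective huw] at hw
    rw [h.eq_of_mem hP hQ hu hw]

omit [DecidableEq α] [DecidableEq β] in
/-- A subset of the image of an embedding is the image of its preimage. [folklore] -/
theorem map_preimage_of_subset_map {V : Finset α} {P' : Finset β} (hP' : P' ⊆ V.map e) :
    (P'.preimage e e.injective.injOn).map e = P' := by
  ext b
  simp only [mem_map, mem_preimage]
  constructor
  · rintro ⟨a, ha, rfl⟩; exact ha
  · intro hb
    obtain ⟨a, -, rfl⟩ := mem_map.1 (hP' hb)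
    exact ⟨a, hb, rfl⟩

/-- **Transport of set partitions along an embedding.** [folklore] -/
theorem setPartitions_map (V : Finset α) :
    setPartitions (V.map e) =
      (setPartitions V).map (mapEmbedding (mapEmbedding e).toEmbedding).toEmbedding := by
  ext π'
  simp only [mem_map, RelEmbedding.coe_toEmbedding, mapEmbedding_apply, mem_setPartitions]
  constructor
  · intro h'
    refine ⟨π'.image fun P' => P'.preimage e e.injective.injOn, ?_, ?_⟩
    · refine ⟨fun P hP => ?_, fun he => ?_, fun v hv => ?_, fun P hP Q hQ v hvP hvQ => ?_⟩
      · obtain ⟨P', hP', rfl⟩ := mem_image.1 hP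
        intro u hu
        rw [mem_preimage] at hu
        exact (mem_map' e).1 (h'.subset hP' hu)
      · obtain ⟨P', hP', hPe⟩ := mem_image.1 he
        have : P' = ∅ := by
          rw [← map_preimage_of_subset_map e (h'.subset hP'), hPe, map_empty]
        exact h'.2.1 (this ▸ hP')
      · obtain ⟨P', hP', hvP'⟩ := h'.exists_mem (mem_map_of_mem e hv)
        exact ⟨_, mem_image_of_mem _ hP', mem_preimage.2 hvP'⟩
      · obtain ⟨P', hP', rfl⟩ := mem_image.1 hP
        obtain ⟨Q', hQ', rfl⟩ := mem_image.1 hQ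
        rw [mem_preimage] at hvP hvQ
        rw [h'.eq_of_mem hP' hQ' hvP hvQ]
    · rw [map_eq_image, image_image]
      conv_rhs => rw [← image_id (s := π')]
      refine image_congr fun P' hP' => ?_
      simp only [Function.comp_apply, RelEmbedding.coe_toEmbedding, mapEmbedding_apply, id]
      exact map_preimage_of_subset_map e (h'.subset (mem_coe.1 hP'))
  · rintro ⟨π, hπ, rfl⟩
    exact hπ.map e

/-- Sums over set partitions transport along embeddings. [folklore] -/
theorem sum_setPartitions_map {M : Type*} [AddCommMonoid M] (V : Finset α)
    (f : Finset (Finset β) → M) :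
    ∑ π' ∈ setPartitions (V.map e), f π' =
      ∑ π ∈ setPartitions V, f (π.map (mapEmbedding e).toEmbedding) := by
  rw [setPartitions_map, sum_map]
  rfl

/-- Sums of products of a function of the block sizes transport along embeddings. [folklore] -/
theorem sum_setPartitions_prod_card_map {M : Type*} [CommSemiring M] (V : Finset α)
    (g : ℕ → M) :
    ∑ π' ∈ setPartitions (V.map e), ∏ P' ∈ π', g P'.card =
      ∑ π ∈ setPartitions V, ∏ P ∈ π, g P.card := by
  rw [sum_setPartitions_map]
  refine sum_congr rfl fun π _ => ?_
  rw [prod_map]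
  simp only [RelEmbedding.coe_toEmbedding, mapEmbedding_apply, card_map]

/-- Edge-freeness transports along an embedding compatible with the adjacencies. [folklore] -/
theorem edgeFreeInd_map {H : α → α → Prop} [DecidableRel H] {H' : β → β → Prop} [DecidableRel H']
    (hHH' : ∀ a b, H' (e a) (e b) ↔ H a b) (V : Finset α) :
    edgeFreeInd H' (V.map e) = edgeFreeInd H V := by
  have hiff : IsCompatible H' (V.map e) ↔ IsCompatible H V := by
    rw [isCompatible_iff', isCompatible_iff']
    refine ⟨fun h u hu w hw huw hH => ?_, fun h u' hu' w' hw' huw' hH' => ?_⟩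
    · exact h (e u) (mem_map_of_mem e hu) (e w) (mem_map_of_mem e hw)
        (fun h' => huw (e.injective h')) ((hHH' u w).2 hH)
    · obtain ⟨u, hu, rfl⟩ := mem_map.1 hu'
      obtain ⟨w, hw, rfl⟩ := mem_map.1 hw'
      exact h u hu w hw (fun h' => huw' (h' ▸ rfl)) ((hHH' u w).1 hH')
  unfold edgeFreeInd
  exact if_congr hiff rfl rfl

/-- **Transport of the Ursell coefficient** along an embedding compatible with the adjacencies
(relabelling invariance). [folklore] -/
theorem hcUrsell_map {H : α → α → Prop} [DecidableRel H] {H' : β → β → Prop} [DecidableRel H']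
    (hHH' : ∀ a b, H' (e a) (e b) ↔ H a b) (V : Finset α) :
    hcUrsell H' (V.map e) = hcUrsell H V := by
  induction V using Finset.strongInduction with
  | H V ih =>
    rw [hcUrsell_eq, hcUrsell_eq, edgeFreeInd_map e hHH']
    congr 1
    have hsing : ({V.map e} : Finset (Finset β)) =
        (mapEmbedding (mapEmbedding e).toEmbedding).toEmbedding {V} := by
      rw [RelEmbedding.coe_toEmbedding, mapEmbedding_apply, map_singleton]; rfl
    rw [setPartitions_map, hsing, ← map_erase, sum_map]
    refine sum_congr rfl fun π hπ => ?_
    simp only [RelEmbedding.coe_toEmbedding, mapEmbedding_apply]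
    rw [prod_map]
    refine prod_congr rfl fun P hP => ?_
    simp only [RelEmbedding.coe_toEmbedding, mapEmbedding_apply]
    obtain ⟨hne, hπ'⟩ := mem_erase.1 hπ
    exact ih P ((mem_setPartitions.1 hπ').ssubset_of_ne_singleton hne hP)

end Map

/-! ### Support: a nonzero Ursell coefficient forces small diameter -/

section Support

variable {H : α → α → Prop} [DecidableRel H]

/-- **Locality of the Ursell coefficient.** If `ℓ` is a pseudo-distance (triangle inequality,
`ℓ a a ≤ 0`) with `ℓ a b ≤ δ` whenever `H a b`, and `c_H(V) ≠ 0`, then any two points of `V` are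
within `(#V - 1) δ`: a nonzero Ursell coefficient forces the `H`-graph on `V` to be connected
(the Ursell function (5.5) is a sum over *connected* graphs). [cite: FriedliVelenik2017, §5.3 (5.5)] -/
theorem hcUrsell_ne_zero_le (hsymm : ∀ a b, H a b → H b a) (ℓ : α → α → ℝ) {δ : ℝ} (hδ : 0 ≤ δ)
    (htri : ∀ a b c, ℓ a c ≤ ℓ a b + ℓ b c) (hrefl : ∀ a, ℓ a a ≤ 0)
    (hH : ∀ a b, H a b → ℓ a b ≤ δ) {V : Finset α} (hV : hcUrsell H V ≠ 0) :
    ∀ u ∈ V, ∀ w ∈ V, ℓ u w ≤ (V.card - 1 : ℝ) * δ := by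
  induction V using Finset.strongInduction with
  | H V ih =>
    intro u hu w hw
    have hcard : (1 : ℝ) ≤ V.card := by exact_mod_cast card_pos.2 ⟨u, hu⟩
    by_cases huw : w = u
    · subst huw
      exact (hrefl w).trans (mul_nonneg (by linarith) hδ)
    · rw [hcUrsell_eq_hcRootedUrsell hsymm hu, hcRootedUrsell] at hV
      obtain ⟨ρ, hρ, hne⟩ := exists_ne_zero_of_sum_ne_zero hV
      have h := mem_setPartitions.1 hρ
      have hw' : w ∈ V.erase u := mem_erase.2 ⟨huw, hw⟩
      set Q := blockOf ρ w with hQdef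
      have hQ : Q ∈ ρ := h.blockOf_mem hw'
      have hwQ : w ∈ Q := h.mem_blockOf hw'
      have hfac : adjInd H u Q * hcUrsell H Q ≠ 0 := by
        intro h0
        exact hne (mul_eq_zero_of_right _ (prod_eq_zero hQ h0))
      have hadj : adjInd H u Q ≠ 0 := fun h0 => hfac (by rw [h0, zero_mul])
      have hcQ : hcUrsell H Q ≠ 0 := fun h0 => hfac (by rw [h0, mul_zero])
      obtain ⟨u', hu'Q, hH'⟩ : ∃ u' ∈ Q, H u u' := by
        by_contra hno
        exact hadj (if_neg hno)
      have hQsub : Q ⊂ V := lt_of_le_of_lt (h.subset hQ) (erase_ssubset hu)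
      have hIH := ih Q hQsub hcQ u' hu'Q w hwQ
      have hQcard : (Q.card : ℝ) ≤ V.card - 1 := by
        have h1 := card_le_card (h.subset hQ)
        rw [card_erase_of_mem hu] at h1
        have h2 : 1 ≤ V.card := card_pos.2 ⟨u, hu⟩
        have h3 : (Q.card : ℝ) + 1 ≤ V.card := by
          exact_mod_cast (by omega : Q.card + 1 ≤ V.card)
        linarith
      calc ℓ u w ≤ ℓ u u' + ℓ u' w := htri u u' w
        _ ≤ δ + (Q.card - 1 : ℝ) * δ := add_le_add (hH u u' hH') hIH
        _ = (Q.card : ℝ) * δ := by ring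
        _ ≤ (V.card - 1 : ℝ) * δ := mul_le_mul_of_nonneg_right hQcard hδ

end Support


/-! ## Tree numbers and the tree-sum bound -/

section TreeNumber

/-- **Cayley's tree numbers by the vertex-deletion recursion**: `t 0 = 0` and
`t (k+1) = ∑_{ρ ∈ setPartitions {0,…,k-1}} ∏_{Q ∈ ρ} #Q · t #Q` (delete the root of a tree on
`k + 1` labelled vertices: the subtrees partition the other `k` vertices and each is attached to
the root at one of its `#Q` vertices), so `t k = k^{k-2}` (`1, 1, 3, 16, 125, …`; Cayley's
formula is not needed and not proved here). [folklore] -/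
def treeNumber : ℕ → ℕ
  | 0 => 0
  | k + 1 => ∑ ρ ∈ (setPartitions (Finset.range k)).attach,
      ∏ Q ∈ ρ.1.attach, (Q.1.card * treeNumber Q.1.card)
termination_by k => k
decreasing_by
  have h := (mem_setPartitions.1 ρ.2).card_le Q.2
  rw [card_range] at h
  omega

/-- Unfolding the recursion. [folklore] -/
theorem treeNumber_succ (k : ℕ) :
    treeNumber (k + 1) = ∑ ρ ∈ setPartitions (range k), ∏ Q ∈ ρ, Q.card * treeNumber Q.card := by
  rw [treeNumber]
  rw [sum_attach (setPartitions (range k))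
    (fun ρ => ∏ Q ∈ ρ.attach, (Q.1.card * treeNumber Q.1.card))]
  exact sum_congr rfl fun ρ _ => prod_attach ρ (fun Q => Q.card * treeNumber Q.card)

/-- `t 1 = 1`. [folklore] -/
@[simp] theorem treeNumber_one : treeNumber 1 = 1 := by
  rw [treeNumber_succ, range_zero, setPartitions_empty, sum_singleton, prod_empty]

/-- Sums over set partitions of products of a function of the block sizes only depend on the
cardinality of the partitioned set. [folklore] -/
theorem sum_setPartitions_prod_card_eq_range {M : Type*} [CommSemiring M] (W : Finset α)
    (g : ℕ → M) :
    ∑ ρ ∈ setPartitions W, ∏ Q ∈ ρ, g Q.card =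
      ∑ ρ ∈ setPartitions (range W.card), ∏ Q ∈ ρ, g Q.card := by
  have h1 : (univ : Finset {x // x ∈ W}).map (Function.Embedding.subtype _) = W := by
    rw [univ_eq_attach, attach_map_val]
  have h2 : (univ : Finset {x // x ∈ W}).map
      ((Fintype.equivFin {x // x ∈ W}).toEmbedding.trans Fin.valEmbedding) = range W.card := by
    rw [← map_map, map_univ_equiv, Fin.map_valEmbedding_univ, Fintype.card_coe, Nat.Iio_eq_range]
  conv_lhs => rw [← h1, sum_setPartitions_prod_card_map]
  rw [← h2, sum_setPartitions_prod_card_map]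

/-- **Size invariance of the tree recursion**: for every finite `W`,
`∑_{ρ ∈ setPartitions W} ∏_{Q ∈ ρ} #Q · t #Q = t (#W + 1)`. [folklore] -/
theorem sum_setPartitions_prod_card_mul_treeNumber (W : Finset α) :
    ∑ ρ ∈ setPartitions W, ∏ Q ∈ ρ, Q.card * treeNumber Q.card = treeNumber (W.card + 1) := by
  rw [treeNumber_succ]
  exact sum_setPartitions_prod_card_eq_range W (fun k => k * treeNumber k)

omit [DecidableEq α] in
/-- The subsets of `W` containing `j` correspond to the subsets of `W \ {j}`. [folklore] -/
theorem sum_filter_mem_eq_sum_powerset_erase [DecidableEq α] {M : Type*} [AddCommMonoid M]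
    (W : Finset α) {j : α} (hj : j ∈ W) (f : Finset α → M) :
    ∑ Q ∈ W.powerset.filter (fun Q => j ∈ Q), f Q = ∑ Q' ∈ (W.erase j).powerset, f (insert j Q') := by
  refine sum_nbij' (fun Q => Q.erase j) (fun Q' => insert j Q') ?_ ?_ ?_ ?_ ?_
  · intro Q hQ
    obtain ⟨hQW, -⟩ := mem_filter.1 hQ
    exact mem_powerset.2 (erase_subset_erase j (mem_powerset.1 hQW))
  · intro Q' hQ'
    have hQ'W := mem_powerset.1 hQ'
    exact mem_filter.2 ⟨mem_powerset.2 (insert_subset hj (hQ'W.trans (erase_subset j W))),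
      mem_insert_self j Q'⟩
  · intro Q hQ
    exact insert_erase (mem_filter.1 hQ).2
  · intro Q' hQ'
    have : j ∉ Q' := fun h => (mem_erase.1 (mem_powerset.1 hQ' h)).1 rfl
    exact erase_insert this
  · intro Q hQ
    rw [insert_erase (mem_filter.1 hQ).2]

/-- The **tree sum** `U_x(W) = ∑_{V ⊆ W} t(#V + 1) x^{#V}`: the generating sum of the trees rooted
at an extra vertex with the other vertices in `W`, weight `x` per non-root vertex. [folklore] -/
def treeSum (x : ℝ) (W : Finset α) : ℝ :=
  ∑ V ∈ W.powerset, (treeNumber (V.card + 1) : ℝ) * x ^ V.card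

omit [DecidableEq α] in
/-- The tree sum is nonnegative for `x ≥ 0`. [folklore] -/
theorem treeSum_nonneg {x : ℝ} (hx : 0 ≤ x) (W : Finset α) : 0 ≤ treeSum x W :=
  sum_nonneg fun _ _ => mul_nonneg (Nat.cast_nonneg _) (pow_nonneg hx _)

/-- The sets containing `j` correspond to the subsets of `W \ {j}`: the weight of the trees through
a fixed non-root vertex is `x · U_x(W \ {j})`. [folklore] -/
theorem sum_filter_mem_treeNumber_mul_pow (x : ℝ) (W : Finset α) {j : α} (hj : j ∈ W) :
    ∑ Q ∈ W.powerset.filter (fun Q => j ∈ Q), (treeNumber Q.card : ℝ) * x ^ Q.card =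
      x * treeSum x (W.erase j) := by
  rw [treeSum, mul_sum]
  refine sum_nbij' (fun Q => Q.erase j) (fun Q' => insert j Q') ?_ ?_ ?_ ?_ ?_
  · intro Q hQ
    obtain ⟨hQW, hjQ⟩ := mem_filter.1 hQ
    exact mem_powerset.2 (erase_subset_erase j (mem_powerset.1 hQW))
  · intro Q' hQ'
    have hQ'W := mem_powerset.1 hQ'
    refine mem_filter.2 ⟨mem_powerset.2 (insert_subset hj (hQ'W.trans (erase_subset j W))),
      mem_insert_self j Q'⟩
  · intro Q hQ
    exact insert_erase (mem_filter.1 hQ).2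
  · intro Q' hQ'
    have : j ∉ Q' := fun h => (mem_erase.1 (mem_powerset.1 hQ' h)).1 rfl
    exact erase_insert this
  · intro Q hQ
    obtain ⟨-, hjQ⟩ := mem_filter.1 hQ
    have hc : Q.card = (Q.erase j).card + 1 := (card_erase_add_one hjQ).symm
    rw [hc, pow_succ]
    ring

/-- **The tree-sum bound.** If `x ≥ 0` and `e · x · #W ≤ 1` then
`U_x(W) = ∑_{V ⊆ W} t(#V+1) x^{#V} ≤ e`. Proof (the Kotecký–Preiss induction without polymers):
by the recursion, `U_x(W)` is a sum over families of disjoint nonempty subsets `Q ⊆ W` of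
`∏ #Q t(#Q) x^{#Q}`, at most `∏_{Q ⊆ W} (1 + #Q t(#Q) x^{#Q}) ≤ exp (∑_Q #Q t(#Q) x^{#Q})`, and
`∑_Q #Q t(#Q) x^{#Q} = ∑_{j ∈ W} x U_x(W \ {j}) ≤ #W · x · e ≤ 1` by induction. [folklore] -/
theorem treeSum_le_exp_one {x : ℝ} (hx : 0 ≤ x) (W : Finset α)
    (hW : Real.exp 1 * x * W.card ≤ 1) : treeSum x W ≤ Real.exp 1 := by
  induction W using Finset.strongInduction with
  | H W ih =>
    -- the weight of a block
    set g : Finset α → ℝ := fun Q => (Q.card : ℝ) * treeNumber Q.card * x ^ Q.card with hg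
    have hg0 : ∀ Q, 0 ≤ g Q := fun Q => by positivity
    -- Step A: expand by the recursion
    have hA : treeSum x W = ∑ V ∈ W.powerset, ∑ ρ ∈ setPartitions V, ∏ Q ∈ ρ, g Q := by
      refine sum_congr rfl fun V _ => ?_
      rw [← sum_setPartitions_prod_card_mul_treeNumber, Nat.cast_sum, sum_mul]
      refine sum_congr rfl fun ρ hρ => ?_
      have h := mem_setPartitions.1 hρ
      rw [← h.sum_card, ← prod_pow_eq_pow_sum, Nat.cast_prod, ← prod_mul_distrib]
      refine prod_congr rfl fun Q _ => ?_
      rw [hg, Nat.cast_mul]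
    -- Step B: forget that the blocks are disjoint and cover
    have hB : ∑ V ∈ W.powerset, ∑ ρ ∈ setPartitions V, ∏ Q ∈ ρ, g Q ≤
        ∑ ρ ∈ W.powerset.powerset, ∏ Q ∈ ρ, g Q := by
      rw [sum_sigma']
      have hinj : Set.InjOn (fun y : (Σ _ : Finset α, Finset (Finset α)) => y.2)
          ↑(W.powerset.sigma fun V => setPartitions V) := by
        rintro ⟨V, ρ⟩ hy ⟨V', ρ'⟩ hy' (hρ : ρ = ρ')
        simp only [coe_sigma, Set.mem_sigma_iff, mem_coe, mem_setPartitions] at hy hy'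
        subst hρ
        have : V = V' := by rw [← hy.2.biUnion_id, ← hy'.2.biUnion_id]
        subst this
        rfl
      rw [← sum_image (g := fun y : (Σ _ : Finset α, Finset (Finset α)) => y.2)
        (f := fun ρ => ∏ Q ∈ ρ, g Q) hinj]
      refine sum_le_sum_of_subset_of_nonneg (fun ρ hρ => ?_) fun ρ _ _ =>
        prod_nonneg fun Q _ => hg0 Q
      obtain ⟨⟨V, ρ'⟩, hy, rfl⟩ := mem_image.1 hρ
      simp only [mem_sigma, mem_powerset, mem_setPartitions] at hy
      exact mem_powerset.2 fun Q hQ => mem_powerset.2 ((hy.2.subset hQ).trans hy.1)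
    -- Step C: binomial expansion and `1 + y ≤ eʸ`
    have hC : ∑ ρ ∈ W.powerset.powerset, ∏ Q ∈ ρ, g Q ≤ Real.exp (∑ Q ∈ W.powerset, g Q) := by
      rw [← prod_one_add, Real.exp_sum]
      exact prod_le_prod (fun Q _ => by linarith [hg0 Q]) fun Q _ => by
        linarith [Real.add_one_le_exp (g Q)]
    -- Step D: the exponent is at most `1`
    have hD : ∑ Q ∈ W.powerset, g Q ≤ 1 := by
      have hexch : ∑ Q ∈ W.powerset, g Q =
          ∑ j ∈ W, ∑ Q ∈ W.powerset.filter (fun Q => j ∈ Q),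
            (treeNumber Q.card : ℝ) * x ^ Q.card := by
        have : ∀ Q ∈ W.powerset, g Q = ∑ _j ∈ Q, (treeNumber Q.card : ℝ) * x ^ Q.card := by
          intro Q _
          simp only [hg, sum_const, nsmul_eq_mul]
          ring
        rw [sum_congr rfl this]
        exact sum_comm' fun Q j => by
          simp only [mem_powerset, mem_filter]
          exact ⟨fun ⟨hQ, hj⟩ => ⟨⟨hQ, hj⟩, hQ hj⟩, fun ⟨⟨hQ, hj⟩, _⟩ => ⟨hQ, hj⟩⟩
      rw [hexch]
      have hbound : ∀ j ∈ W, ∑ Q ∈ W.powerset.filter (fun Q => j ∈ Q),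
          (treeNumber Q.card : ℝ) * x ^ Q.card ≤ x * Real.exp 1 := by
        intro j hj
        rw [sum_filter_mem_treeNumber_mul_pow x W hj]
        refine mul_le_mul_of_nonneg_left (ih _ (erase_ssubset hj) ?_) hx
        refine le_trans ?_ hW
        have : ((W.erase j).card : ℝ) ≤ W.card := by exact_mod_cast card_le_card (erase_subset j W)
        have h0 : 0 ≤ Real.exp 1 * x := by positivity
        nlinarith
      calc ∑ j ∈ W, ∑ Q ∈ W.powerset.filter (fun Q => j ∈ Q),
            (treeNumber Q.card : ℝ) * x ^ Q.card
          ≤ ∑ _j ∈ W, x * Real.exp 1 := sum_le_sum hbound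
        _ = Real.exp 1 * x * W.card := by rw [sum_const, nsmul_eq_mul]; ring
        _ ≤ 1 := hW
    calc treeSum x W = _ := hA
      _ ≤ _ := hB
      _ ≤ _ := hC
      _ ≤ Real.exp 1 := Real.exp_le_exp.2 hD

/-- The tree-sum bound in binomial form: `∑_{k ≤ m} C(m,k) t(k+1) x^k ≤ e` if `e x m ≤ 1`.
[folklore] -/
theorem sum_choose_mul_treeNumber_mul_pow_le {x : ℝ} (hx : 0 ≤ x) {m : ℕ}
    (hm : Real.exp 1 * x * m ≤ 1) :
    ∑ k ∈ range (m + 1), (m.choose k : ℝ) * treeNumber (k + 1) * x ^ k ≤ Real.exp 1 := by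
  have h := treeSum_le_exp_one hx (range m) (by rwa [card_range])
  rw [treeSum, sum_powerset_apply_card (fun k => (treeNumber (k + 1) : ℝ) * x ^ k), card_range] at h
  simpa only [nsmul_eq_mul, mul_assoc] using h

/-- The tree-sum bound in exponential-generating form: `∑_{k < K} t(k+1) yᵏ / k! ≤ e` for
`0 ≤ y` with `e y ≤ 1` (let `m → ∞` in the binomial form with `x = y/m`; this is the statement
that the rooted-tree generating function `R(y) = ∑ k^{k-1} yᵏ/k!` satisfies `R(1/e) ≤ 1`).
[folklore] -/
theorem sum_range_treeNumber_mul_pow_div_factorial_le {y : ℝ} (hy : 0 ≤ y)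
    (hy' : Real.exp 1 * y ≤ 1) (K : ℕ) :
    ∑ k ∈ range K, (treeNumber (k + 1) : ℝ) * y ^ k / k.factorial ≤ Real.exp 1 := by
  -- the binomial sums converge termwise
  have hlim : ∀ k, Filter.Tendsto (fun m : ℕ => (m.choose k : ℝ) * treeNumber (k + 1) * (y / m) ^ k)
      Filter.atTop (nhds ((treeNumber (k + 1) : ℝ) * y ^ k / k.factorial)) := by
    intro k
    have hr : Filter.Tendsto (fun n : ℕ => (n : ℝ) * (y / n)) Filter.atTop (nhds y) := by
      refine tendsto_const_nhds.congr' ?_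
      filter_upwards [Filter.eventually_ge_atTop 1] with n hn
      have : (n : ℝ) ≠ 0 := by exact_mod_cast (by omega : n ≠ 0)
      field_simp
    have h := (ProbabilityTheory.tendsto_choose_mul_pow_atTop k hr).const_mul
      (treeNumber (k + 1) : ℝ)
    refine (h.congr fun m => by ring).trans ?_
    rw [show (treeNumber (k + 1) : ℝ) * (y ^ k / k.factorial) =
      (treeNumber (k + 1) : ℝ) * y ^ k / k.factorial by ring]
  have hsum := tendsto_finsetSum (range K) fun k _ => hlim k
  refine le_of_tendsto hsum ?_
  filter_upwards [Filter.eventually_ge_atTop (max K 1)] with m hm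
  have hmK : K ≤ m := le_of_max_le_left hm
  have hm1 : 1 ≤ m := le_of_max_le_right hm
  have hx : 0 ≤ y / m := by positivity
  have hxm : Real.exp 1 * (y / m) * m ≤ 1 := by
    have : (m : ℝ) ≠ 0 := by exact_mod_cast (by omega : m ≠ 0)
    rwa [mul_assoc, div_mul_cancel₀ _ this]
  refine le_trans ?_ (sum_choose_mul_treeNumber_mul_pow_le hx hxm)
  refine sum_le_sum_of_subset_of_nonneg (range_subset_range.2 (by omega)) fun k _ _ => ?_
  positivity

end TreeNumber

end Literature.Probability.LatticeModels
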